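import Summits.QuantumFields.Balaban3D.Proofs.Run3Representation
import Summits.QuantumFields.Balaban3D.Proofs.SeriesAC

/-!
# `Summit.QuantumFields.Balaban3D.Proofs.LeavesReprAC` — the series step leaves C5 `Repr33_60`, C6 `VacuumWhole`, C7 `Decomp35_61`,
# C8 `Norm35`, B20 `logZT_le` AT THE AC TOWER's pieces `SeriesAC.TowerBaseAC.seriesPiecesAC B 𝔖 C k` — seat p6's `Run3Representation`
# §C5–§B20 twinned over `TowerBaseAC` (uncapped masses, `AvgAC` averaging) — lane `pub-balaban3d`, seat alpha-1 (definition request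
# `defn-AlphaInputsT3AC` of route `UnitScaleTilt`; feed theorem `Thm2AC`)

These leaves are statements about the EXPANSION DATA `𝔖` read through the step pieces; they do not involve the masses or the averaging, and
their proofs are seat p6's verbatim with `seriesPieces` ↦ `seriesPiecesAC` (every callee — `Representation33.repr33_60_of_chart`, `ofDecay`,
`VacuumAndBooking.vacuumWhole_torus`, `LogZLocalized.decomp35_61_of_localization`, the GAP-binder lemmas — is generic over `B10.TowerRun` /
`StepPieces`).  A definitional transfer from the lane's pieces at the axial companion was tried and is too expensive for the kernel (the two
`TowerRun`s differ in `LF`), hence the twin.  [folklore] bookkeeping around seat p6's theorems; nothing of [Balaban1985UV3] newly asserted.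
-/

noncomputable section

open scoped Topology
open Metric Set Finset MeasureTheory
open Literature.MathematicalPhysics.QuantumFieldTheory.Balaban1983to89
open Literature.MathematicalPhysics.QuantumFieldTheory.Balaban1983to89.B10
open Literature.MathematicalPhysics.QuantumFieldTheory.Balaban1983to89.B10SectAGathering
open Literature.MathematicalPhysics.QuantumFieldTheory.Balaban1983to89.B10Assembly
open Literature.MathematicalPhysics.QuantumFieldTheory.Balaban1983to89.B12TreeDecay (kappa₀ K₀ K₀_pos)
open Literature.MathematicalPhysics.QuantumFieldTheory.Balaban1983to89.TreeLengthTorus (tsys tcubeSys TPt)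
open Literature.MathematicalPhysics.QuantumFieldTheory.Balaban1985CMP102
open Literature.MathematicalPhysics.QuantumFieldTheory.Balaban1985CMP102.Setting
open Literature.MathematicalPhysics.QuantumFieldTheory.Balaban1985CMP102.Binders
  (ChartAnalyticityAsCited FarTermsDecayAsCited Norm35StepAsCited LogZTExtensiveAsCited)
open Summit.QuantumFields.Balaban3D.Proofs.Representation33
open Summit.QuantumFields.Balaban3D.Proofs.VacuumAndBooking
open Summit.QuantumFields.Balaban3D.Proofs.ChartFromBound25
open Summit.QuantumFields.Balaban3D.Proofs.LogZLocalized
open Summit.QuantumFields.Balaban3D.Carriers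
open Summit.QuantumFields.Balaban3D.Proofs.ScalesArithmetic
open Summit.QuantumFields.Balaban3D.Proofs.Run3Representation (eq32_of_inv26)
open Summit.QuantumFields.Balaban3D.Proofs.TowerAC
open Summit.QuantumFields.Balaban3D.Proofs.SeriesAC

namespace Summit.QuantumFields.Balaban3D.Proofs.LeavesReprAC

variable {L : ℕ} {S : Scales L} {G : Type} [GaugeGroup G] [MeasurableSpace G] [HaarData G]
  {V : Type} [NormedAddCommGroup V] [NormedSpace ℂ V] {Nc : ℕ → ℕ} [∀ k, NeZero (Nc k)]
  (B : TowerBaseAC S G) (𝔖 : ∀ k, StepSeries S G V (Nc k) k) (C : ∀ k, PiecesParams S k) (k : ℕ)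

/-- **Leaf `Repr33_60` (LEAF-LEDGER C5) for `B.seriesPiecesAC 𝔖 C k`** — (33) p. 264 / (60) p. 271 «Σ_X 𝒫′_{k+1}(g_k, X,
U_{k+1}) = Σ_X 𝒫′_{k+1}(g_k, X, 1) + Σ_{Y_{k+1}} 𝒫_{k+1}(g_k, Y_{k+1}, U_{k+1}) + O((L^kε)^{3+κ₀})|T₁^{(k)}|» for the
lane's DEFINED `PprU = Σ_{X ∈ loc h} Re Ψ_X(B_X(h,U))`, `Ppr1 = Σ_{X ∈ loc h} Re Ψ_X(0)` (seat p1's `StepSeries`, R-29 /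
R-ACT / R-FL) and the DATA `PY`, with constant `C₂ := rawConst7 Craw b₀ r₀ p₀ 1 κ₀` (normalised units, R-NORM).
INPUTS, all (α) per the lane's R-DISP: G3D-01 `ChartAnalyticityAsCited` at the (25)-rate `C25·g_k·e^{−κ𝓛(X)}` (R-ACT),
(28) `bound28` and its smallness `small28` («for g₀ sufficiently small the number on the right-hand side above is
small», p. 263 L32–33), (26) in the chart space `inv26` with the detecting property `hdet` of the action (⇒ (32)),
G3D-06 `FarTermsDecayAsCited`, and the ONE identification `hPY` of the data `PY` with the retained order-2…6 jet minus
the far monomials (ruling batch 11 (a)); run slots: `k ≤ K`, `κ ≥ κ₀(32, 6)`, `C25·K₀(32,6) ≤ CM`, `0 < κ₀ < ½`,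
`p₀ > 0`, `b₀ ≥ 0`, `N³ ≤ |T₁^{(k)}|`, `rem_k = (L^kg₀²)^{3+κ₀}|T₁^{(k)}|` (the chart space `PBond S.P k → V` is PINNED,
ruling R-32′, and finite-dimensional with `V`).  The identifications `PprU = total`, `Ppr1 = total0` hold BY `rfl`
over the DEFINED blocks `ΩblkOf B.M₁ B.Rcol (Nc k) h` and retained radius `B.Rret k` (ruling R-OMEGA). [cite: Balaban1985UV3, (33) p.264 + (60) p.271] -/
theorem repr33_60_seriesAC [FiniteDimensional ℂ V] (hk : k ≤ S.K) (κc : ChartConsts) {κ C25 : ℝ}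
    (hκ : kappa₀ (4 * 2 ^ 3) (2 * 3) ≤ κ) (hC25 : 0 ≤ C25) (hCM : C25 * K₀ (4 * 2 ^ 3) (2 * 3) ≤ κc.CM)
    (hκ₀ : B.κ₀ < 1 / 2) (hp₀ : 0 < B.p₀) (hb₀ : 0 ≤ B.b₀)
    (hblocks : ((Nc k : ℕ) : ℝ) ^ 3 ≤ S.sites k)
    (hrem : (C k).rem = ((L : ℝ) ^ k * S.g0sq) ^ (3 + B.κ₀) * S.sites k)
    (chart : ∀ X, ChartAnalyticityAsCited ((𝔖 k).Ψ X) κc.ρ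
      (C25 * S.gk k * Real.exp (-(κ * (tsys 3 (Nc k)).dj X))))
    (bound28 : ∀ X h U, ‖(𝔖 k).Bcfg X h U‖ ≤ κc.cB * (rFun κc.r₀ (S.gk k) * S.gk k * pFun B.b₀ B.p₀ (S.gk k)))
    (small28 : κc.cB * (rFun κc.r₀ (S.gk k) * S.gk k * pFun B.b₀ B.p₀ (S.gk k)) ≤ κc.ρ / 4)
    {Γ : Type*} (π : Γ → (𝔖 k).E →L[ℂ] (𝔖 k).E)
    (inv26 : ∀ X u, ∀ b ∈ ball (0 : (𝔖 k).E) κc.ρ, π u b ∈ ball (0 : (𝔖 k).E) κc.ρ →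
      (𝔖 k).Ψ X (π u b) = (𝔖 k).Ψ X b)
    (hdet : ∀ φ : (𝔖 k).E →L[ℂ] ℂ, (∀ u, φ.comp (π u) = φ) → φ = 0)
    (far_le : FarTermsDecayAsCited (𝔖 k).far (fun X => C25 * S.gk k * Real.exp (-(κ * (tsys 3 (Nc k)).dj X)))
      κc.Cfar (S.gk k ^ 7 * (rFun κc.r₀ (S.gk k) * pFun B.b₀ B.p₀ (S.gk k)) ^ 7))
    (hPY : ∀ h U, (𝔖 k).PY h U
      = ∑ X ∈ (𝔖 k).loc (ΩblkOf B.M₁ B.Rcol (Nc k)) (B.Rret k) h, ((jet26 ((𝔖 k).Ψ X) ((𝔖 k).Bcfg X h U)).re - (𝔖 k).far X h U)) :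
    Repr33_60 (B.seriesPiecesAC 𝔖 C k) (rawConst7 κc.Craw B.b₀ κc.r₀ B.p₀ 1 B.κ₀) := by
  have hg0 : 0 < S.gk k := gk_pos S k
  have hg1 : S.gk k ≤ 1 := gk_le_one S S.gK_le_one k hk
  have eq32 : ∀ X, fderiv ℂ ((𝔖 k).Ψ X) 0 = 0 := eq32_of_inv26 (𝔖 k).Ψ _ chart π inv26 hdet
  have hA : 0 ≤ C25 * S.gk k := mul_nonneg hC25 hg0.le
  have hCM' : C25 * S.gk k * K₀ (4 * 2 ^ 3) (2 * 3) ≤ κc.CM := by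
    have hK : 0 < K₀ (4 * 2 ^ 3) (2 * 3) := K₀_pos _ _
    nlinarith [mul_nonneg hC25 hK.le]
  have hcard : (Fintype.card (tcubeSys 3 (Nc k)).Cube : ℝ) ≤ S.sites k := by
    rw [TreeLengthTorus.card_tcube]; push_cast; exact hblocks
  let D : ChartExpansion (B.withSeriesAC 𝔖 C).tower3.toTowerRun k (tsys 3 (Nc k)).Dom (𝔖 k).E κc :=
    ofDecay (T := (B.withSeriesAC 𝔖 C).tower3.toTowerRun) (k := k) (tcubeSys 3 (Nc k))
      (TreeLengthTorus.tdegreeLE 3 _) (TreeLengthTorus.tvolumeLeaf 3 _) hκ hA κc hCM'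
      ((𝔖 k).loc (ΩblkOf B.M₁ B.Rcol (Nc k)) (B.Rret k)) (𝔖 k).Ψ
      (fun X => C25 * S.gk k * Real.exp (-(κ * (tsys 3 (Nc k)).dj X))) chart (fun X => le_rfl)
      (𝔖 k).Bcfg bound28 small28 eq32 hcard (𝔖 k).far far_le
  exact repr33_60_of_chart (B.seriesPiecesAC 𝔖 C k) D 1 L S.g0sq B.κ₀ one_pos (L_pos S) (g0sq_pos S) hκ₀ hp₀ hb₀
    (gk_eq_gRun_norm S k) hg1 hrem (fun _ _ => rfl) (fun _ => rfl) hPY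

/-! ## C6 — `VacuumWhole` for the series' pieces (p. 265 L2–4 / p. 270 L30–33) -/

/-- The retained set `StepSeries.loc (ΩblkOf M₁ Rcol N) (Rret k) h` of seat p1 (R-OMEGA: blocks and radius DEFINED by
the tower base) IS `ChartFromBound25.retained` / the index set of `VacuumAndBooking.vacuumWhole_torus` once `Rret k =
R₁·r(g_k)` ((59) p. 270 L35 «contained in cubes of the size R(g_k)M₁», (39) p. 266 `R(g_k) = R₁r(g_k)`; in the standard
tower `rretOf`, by `rfl`). [cite: Balaban1985UV3, (59) p.270 + (39) p.266] -/
theorem loc_eq_filterAC {R₁ r₀ : ℝ} (hRret : R₁ * rFun r₀ (S.gk k) = B.Rret k) (h : Hist S.P (k + 1)) :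
    (𝔖 k).loc (ΩblkOf B.M₁ B.Rcol (Nc k)) (B.Rret k) h = (Finset.univ.filter
        (fun X : (tsys 3 (Nc k)).Dom => (tcubeSys 3 (Nc k)).cubes X ⊆ ΩblkOf B.M₁ B.Rcol (Nc k) h)).filter
        (fun X => (tsys 3 (Nc k)).dj X < R₁ * rFun r₀ (S.gk k)) := by
  ext X
  simp only [StepSeries.loc, Finset.mem_filter, Finset.mem_univ, true_and, TreeLengthTorus.tcubeSys_cubes, ← hRret]
  exact Iff.rfl

/-- **Leaf `VacuumWhole` (LEAF-LEDGER C6) for `B.seriesPiecesAC 𝔖 C k`** — p. 270 L30–33 «Terms with localization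
domains X having non-empty intersections with Ω^c_{k+1} are estimated by O(g_k)|Z_k|. Terms with domains X, which are
not contained in a cube of the size R(g_k)M₁, are estimated by O((L^kε)^{3+κ₀})|T₁^{(k)}|» (k = 0: p. 265 L2–4) for the
lane's DEFINED `PprT = Σ_X Re Ψ_X(0)` (all domains) and `Ppr1 = Σ_{X ∈ loc h} Re Ψ_X(0)`, from G3D-01 at the (25)-rate
ALONE (its bound at the chart centre `B = 0` is (25) at `U = 1`): `VacuumWhole P (C25·K₀(32,6)) (rawConstR (C25·K₀(32,6))
R₁ 1 κ₀)` (`VacuumAndBooking.vacuumWhole_torus`), given `κ ≥ κ₀(32,6) + 1`, the located windows `r₀ ≥ 1`, `R₁ ≥ 6 +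
2κ₀`, `κ₀ > 0`, the retained radius `Rret k = R₁r(g_k)` and `N³ ≤ |T₁^{(k)}|`; the block count `#(blocks ∖
Ω_{k+1}(h)) ≤ |Z_k(h)|` is seat p1's THEOREM `Carriers.seriesPieces_hZ` (R-OMEGA), discharged inside. [cite: Balaban1985UV3, p.270 + p.265 + (25) p.262] -/
theorem vacuumWhole_seriesAC (hk : k ≤ S.K) {ρ κ C25 r₀ R₁ : ℝ} (hκ : kappa₀ (4 * 2 ^ 3) (2 * 3) + 1 ≤ κ)
    (hC25 : 0 ≤ C25) (hκ₀ : 0 < B.κ₀) (hr₀ : 1 ≤ r₀) (hR₁ : 6 + 2 * B.κ₀ ≤ R₁)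
    (hblocks : ((Nc k : ℕ) : ℝ) ^ 3 ≤ S.sites k)
    (hrem : (C k).rem = ((L : ℝ) ^ k * S.g0sq) ^ (3 + B.κ₀) * S.sites k)
    (hRret : B.Rret k = R₁ * rFun r₀ (S.gk k))
    (chart : ∀ X, ChartAnalyticityAsCited ((𝔖 k).Ψ X) ρ
      (C25 * S.gk k * Real.exp (-(κ * (tsys 3 (Nc k)).dj X)))) :
    VacuumWhole (B.seriesPiecesAC 𝔖 C k) (C25 * K₀ (4 * 2 ^ 3) (2 * 3))
      (rawConstR (C25 * K₀ (4 * 2 ^ 3) (2 * 3)) R₁ 1 B.κ₀) := by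
  have hg1 : S.gk k ≤ 1 := gk_le_one S S.gK_le_one k hk
  have h25 : Bound25Printed ⟨(tsys 3 (Nc k)).Dom, Unit, (tsys 3 (Nc k)).dj,
      fun X _ => ((𝔖 k).Ψ X 0).re⟩ (S.gk k) κ C25 := by
    intro X _
    have hρ : 0 < ρ := (chart X).1
    exact (Complex.abs_re_le_norm _).trans ((chart X).2.2 0 (mem_closedBall_self (by positivity)))
  refine vacuumWhole_torus (Nc k) (B.seriesPiecesAC 𝔖 C k) hκ (fun X (_ : Unit) => ((𝔖 k).Ψ X 0).re) () hC25
    h25 (fun h => ΩblkOf B.M₁ B.Rcol (Nc k) h) 1 L S.g0sq B.κ₀ r₀ R₁ one_pos (L_pos S) (g0sq_pos S) hκ₀ hr₀ hR₁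
    (gk_eq_gRun_norm S k) hg1 hrem rfl (fun h => ?_) (B.seriesPiecesAC_hZ 𝔖 C k) hblocks
  show ∑ X ∈ (𝔖 k).loc (ΩblkOf B.M₁ B.Rcol (Nc k)) (B.Rret k) h, ((𝔖 k).Ψ X 0).re = _
  rw [loc_eq_filterAC B 𝔖 k hRret.symm h]
  rfl

/-! ## C7 — `Decomp35_61` for the series' pieces ((61) p. 271, «analogously to (60)») -/

/-- **Leaf `Decomp35_61` (LEAF-LEDGER C7) for `B.seriesPiecesAC 𝔖 C k`** — p. 271 L20–21 «To complete the proof of the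
inductive assumption (41) we have to expand the term (61) analogously to (60)» for the lane's DEFINED `logZU = J_U +
log ∫ e^{−½⟨v, Q_U v⟩}`, `logZ1 = J_1 + log ∫ e^{−½⟨v, Q_1 v⟩}` (R-FL) and the DATA `PYZ`: IF the two logarithms admit
the localized representation «(63) as cited» (`LogZLocalized.LogZLocalization`, over the SAME chart configurations
`Bcfg` and the domains inside the DEFINED blocks `ΩblkOf B.M₁ B.Rcol (Nc k) h` of `B(Λ_{k+1}(h))`, rate `C63·e^{−κ𝓛}`;
the lane's GAP binder G3D-07 via `LogZLocalization.ofCited`), the chart configurations obey (28) + smallness,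
`PYZ` IS the retained jet of the pieces, and the run slots hold (`Rret k = R₁r(g_k)`, `r₀ ≥ 1`, `R₁ ≥ 6 + 2κ₀`,
`0 < κ₀ < ½`, `κ ≥ κ₀(32,6) + 1`, `C63·K₀(32,6) ≤ CM`, `N³ ≤ |T₁^{(k)}|`, normalised `rem`), THEN
`Decomp35_61 P (rawConst7 Craw b₀ r₀ p₀ 1 κ₀ + rawConstR (2·C63·K₀(32,6)) R₁ 1 κ₀)` —
`LogZLocalized.decomp35_61_of_localization` at the torus block carrier. [cite: Balaban1985UV3, (61) p.271 + (63) p.272 + (35) p.265] -/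
theorem decomp35_61_seriesAC [FiniteDimensional ℂ V] (hk : k ≤ S.K) (κc : ChartConsts) {κ C63 R₁ : ℝ}
    (hκ : kappa₀ (4 * 2 ^ 3) (2 * 3) + 1 ≤ κ) (hC63 : 0 ≤ C63) (hCM : C63 * K₀ (4 * 2 ^ 3) (2 * 3) ≤ κc.CM)
    (hr₀ : 1 ≤ κc.r₀) (hκ₀ : 0 < B.κ₀) (hκ₀' : B.κ₀ < 1 / 2) (hR₁ : 6 + 2 * B.κ₀ ≤ R₁) (hp₀ : 0 < B.p₀)
    (hb₀ : 0 ≤ B.b₀) (hblocks : ((Nc k : ℕ) : ℝ) ^ 3 ≤ S.sites k)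
    (hrem : (C k).rem = ((L : ℝ) ^ k * S.g0sq) ^ (3 + B.κ₀) * S.sites k)
    (hRret : B.Rret k = R₁ * rFun κc.r₀ (S.gk k))
    (bound28 : ∀ X h U, ‖(𝔖 k).Bcfg X h U‖ ≤ κc.cB * (rFun κc.r₀ (S.gk k) * S.gk k * pFun B.b₀ B.p₀ (S.gk k)))
    (small28 : κc.cB * (rFun κc.r₀ (S.gk k) * S.gk k * pFun B.b₀ B.p₀ (S.gk k)) ≤ κc.ρ / 4)
    (Λ : LogZLocalization (B.withSeriesAC 𝔖 C).tower3.toTowerRun k (𝔖 k).E κc κ C63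
      (B.seriesPiecesAC 𝔖 C k).logZU (B.seriesPiecesAC 𝔖 C k).logZ1 (𝔖 k).Bcfg
      (fun h => Finset.univ.filter fun X : (tsys 3 (Nc k)).Dom => X.1 ⊆ ΩblkOf B.M₁ B.Rcol (Nc k) h))
    (hPYZ : ∀ h U, (𝔖 k).PYZ h U
      = ∑ X ∈ (𝔖 k).loc (ΩblkOf B.M₁ B.Rcol (Nc k)) (B.Rret k) h, ((jet26 (Λ.Ψ X) ((𝔖 k).Bcfg X h U)).re - Λ.far X h U)) :
    Decomp35_61 (B.seriesPiecesAC 𝔖 C k)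
      (rawConst7 κc.Craw B.b₀ κc.r₀ B.p₀ 1 B.κ₀ + rawConstR (2 * C63 * K₀ (4 * 2 ^ 3) (2 * 3)) R₁ 1 B.κ₀) := by
  have hg1 : S.gk k ≤ 1 := gk_le_one S S.gK_le_one k hk
  have hcard : (Fintype.card (tcubeSys 3 (Nc k)).Cube : ℝ) ≤ S.sites k := by
    rw [TreeLengthTorus.card_tcube]; push_cast; exact hblocks
  refine decomp35_61_of_localization (B.seriesPiecesAC 𝔖 C k) (tcubeSys 3 (Nc k)) (TreeLengthTorus.tdegreeLE 3 _)
    (TreeLengthTorus.tvolumeLeaf 3 _) hκ κc hCM hr₀ (𝔖 k).Bcfg bound28 small28 _ hcard Λ hC63 1 L S.g0sq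
    B.κ₀ R₁ one_pos (L_pos S) (g0sq_pos S) hκ₀ hκ₀' hR₁ hp₀ hb₀ (gk_eq_gRun_norm S k) hg1 hrem (fun h U => ?_)
  show (𝔖 k).PYZ h U = _
  rw [hPYZ h U, loc_eq_filterAC B 𝔖 k hRret.symm h]
  rfl

/-- **What the G3D-07 input asserts about the lane's data** (the first step of the recorded reduction path, ruling
R-G7): for the DEFINED `logZU = J_U + log ∫ e^{−½⟨v, Q_U v⟩}`, `logZ1 = J_1 + log ∫ e^{−½⟨v, Q_1 v⟩}` (seat p1, R-FL) with
positive definite precision matrices ((54) p. 269 «determined by the positive operator»; [5] Thm 3.11), the difference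
(61) IS `(J_U − J_1) + ½(log det Q_1 − log det Q_U)` — p. 271 L34–36 «Its logarithm is equal to a sum of an absolute
constant, cancelled by the same constant from the second term in (61), and the expression ½ log det(C*Δ_kC)⁻¹», LQB
`B10LogDet63.log_gaussian_diff61` (the constants `(dim/2)·log 2π` cancel).  Hence `LogZLocalization.expandDiff` at
`seriesPieces` reads: `(J_U − J_1) + ½(log det Q_1 − log det Q_U) = Σ_{X ⊂ B(Λ_{k+1})} (Re Ψ_X(B(h,U)) − Re Ψ_X(0))` — the
localization of the log-determinant difference ((63) + [5] (3.156)/(3.183)/(3.185): LQB `B10LogDet63.matrix63`,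
`diff61_split`, `sum_Elog_eq` under `G3WalkBound`) together with that of the elimination constants `J`.
[cite: Balaban1985UV3, (61) p.271 + (63) p.272 + (54) p.269] -/
theorem logZU_sub_logZ1_eqAC (h : Hist S.P (k + 1)) (U : GaugeField S.P (k + 1) G)
    (hQU : ((𝔖 k).QU h U).PosDef) (hQ1 : ((𝔖 k).Q1 h).PosDef) :
    (B.seriesPiecesAC 𝔖 C k).logZU h U - (B.seriesPiecesAC 𝔖 C k).logZ1 h
      = ((𝔖 k).JU h U - (𝔖 k).J1 h)
        + (1 / 2) * (Real.log ((𝔖 k).Q1 h).det - Real.log ((𝔖 k).QU h U).det) := by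
  show (𝔖 k).JU h U + StepSeries.gaussLog ((𝔖 k).QU h U) - ((𝔖 k).J1 h + StepSeries.gaussLog ((𝔖 k).Q1 h)) = _
  have hd := B10LogDet63.log_gaussian_diff61 ((𝔖 k).Q1 h) ((𝔖 k).QU h U) hQ1 hQU
  unfold StepSeries.gaussLog
  linarith

/-! ## C8, B20 — the two normalisation bounds are the GAP binders G3D-04/05 BY NAME -/

/-- **Leaf `Norm35` (LEAF-LEDGER C8) for `B.seriesPiecesAC 𝔖 C k`**: (35) p. 265 «|log(Z^{(0)}(Ω₁,1)/Z^{(0)}(T₁,1))| ≤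
O(1)|Ω₁ᶜ|» and its unprinted k ≥ 1 analogue = the lane's GAP binder G3D-04 `Binders.Norm35StepAsCited` (a
`B10Eq35Norm.Norm35Model` per history for the DEFINED `logZ1`, `logZT` of the series) ⇒ `Norm35 P (cv·(log 2π +
max(|log c|, |log a|))/2 + cJ)` by `Norm35StepAsCited.norm35` (LQB `norm35_of_model`). [cite: Balaban1985UV3, (35) p.265] -/
theorem norm35_seriesAC {c a cv cJ : ℝ} (hc : 0 < c) (h35 : Norm35StepAsCited (B.seriesPiecesAC 𝔖 C k) c a cv cJ) :
    Norm35 (B.seriesPiecesAC 𝔖 C k) (cv * ((Real.log (2 * Real.pi) + max |Real.log c| |Real.log a|) / 2) + cJ) :=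
  h35.norm35 hc

/-- **`|log Z^{(k)}(T₁^{(k)}, 1)| ≤ z·|T₁^{(k)}|` (LEAF-LEDGER B20, `LeafSystem.logZT_le`) for `B.seriesPiecesAC 𝔖 C k`**:
the lane's GAP binder G3D-05 `Binders.LogZTExtensiveAsCited` for the DEFINED `logZT = J_T + log ∫ e^{−½⟨v, Q_T v⟩}`
⇒ the volume bound with `z := cn·(log 2π + max(|log c|, |log a|))/2 + cJ` by `LogZTExtensiveAsCited.logZT_le`;
`|T₁^{(k)}|` is `S.sites k` (definitionally the tower's `sites`). [cite: Balaban1985UV3, (65) p.273 + (62) p.271] -/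
theorem logZT_le_seriesAC {c a cn cJ : ℝ} (hc : 0 < c)
    (hZT : LogZTExtensiveAsCited (B.seriesPiecesAC 𝔖 C k) c a cn cJ) :
    |(B.seriesPiecesAC 𝔖 C k).logZT|
      ≤ (cn * ((Real.log (2 * Real.pi) + max |Real.log c| |Real.log a|) / 2) + cJ) * S.sites k :=
  hZT.logZT_le hc


end Summit.QuantumFields.Balaban3D.Proofs.LeavesReprAC

end
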